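import Literature.Algebra.EuclideanLattices.IntegerMatrixInverseGS
import Literature.Algebra.EuclideanLattices.MRShortVectorsIteration
import Literature.Algebra.EuclideanLattices.SmoothingParameterBounds
import Literature.Algebra.EuclideanLattices.IntegerBases
import Literature.Computability.Complexity.AOWListMatrixFP
import Literature.Computability.Complexity.CodeFPArith
import Literature.Computability.Cryptography.CoinChunks
import HarnessLib

/-!
# Micciancio–Regev 2007, Lemma 5.10 (`GIVP ← IncGDD`) as a list program: the loop, its oracle instances, and its deterministic invariants

Topic `Algebra/EuclideanLattices` (family `pqc`). First of three files realising MR07's Lemma 5.10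
(authors' version p. 24: "there exists a reduction from `GIVP^φ_{8γ}` to `IncGDD^φ_{γ,8}`" — start with
`S = B`; repeatedly pick the longest `sᵢ`, a target `t ⊥ {sⱼ}ⱼ≠ᵢ` of length `‖S‖/2`, call the
`IncGDD` oracle on `(B, S, t, ‖S‖/8)`, replace `sᵢ` by the answer `u` (`‖u - t‖ ≤ ‖S‖/4`, so
`‖u‖ ≤ 3‖S‖/4` and `u ∉ span {sⱼ}ⱼ≠ᵢ`) or stop; "log ∏‖sᵢ‖ decreases by a constant at each step") at
MACHINE level, i.e. the loop behind Cor. 5.13 as invoked in the first step of the proof of Thm. 5.23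
(p. 29), which is what separates the named fact
`Literature.Computability.Cryptography.owfExist_of_gapSVP_worstCaseHard` from a proof along the
verifier-free route (`Cryptography/GapSVPFromShortDualSets.lean`,
`owfExist_of_gapSVP_worstCaseHard_of_shortDual`) once an `IncGDD` solver machine (Thm. 5.9) is given.

This file is the PURE part: the loop as total functions on lists of integers (the data the machine of
`MRLemma510Machine.lean` manipulates and `MRLemma510Law.lean` analyses), with machine-friendly constants,
and its deterministic invariants. The oracle is an arbitrary answer function `sol : List Bool → List Bool →
List Bool` (instance code, coins ↦ answer); the loop VERIFIES answers itself, so nothing is assumed of `sol`.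

* `IncGDDInst` — the wire format of an `IncGDD` instance for an INTEGER lattice: `(n, U, V, tw, td, rn,
  rd, pad)` meaning `Λ = L(U)` (`U ∈ ℤⁿˣⁿ` nonsingular, rows), `S =` rows of `V` (`⊂ Λ`, independent),
  `t = tw/td`, `r = rn/rd`, `pad` ignored (it only equalises code lengths); `IncGDDInst.encode` (a
  `CodeFP` pair code); the semantic readings `lattice`, `rowVec`, `target`, `radius`; the total answer
  reader `readVec` (`readVec (rawE intE z) = z`) and the good answers `goodAnswers J`
  (`‖z U - t‖ ≤ ‖S‖/8 + r`, MR07 Def. 5.6 with `g = 8`);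
* one round (`roundIdx`, `roundTarget`, `roundInst`, `verify`, `roundUpdate`) and the loop `loopRun`:
  `i = argmax ‖vⱼ‖²`, `w = GSInverse.invCol V i` (integral, `⊥ vⱼ` for `j ≠ i`), `t = ut·w/2^ℓ` with
  `‖S‖/2 ≤ ‖t‖ ≤ 5‖S‖/8` (`ℓ = 3 + size ‖w‖²`, `ut = ⌊√(4^ℓ‖S‖²/(4‖w‖²))⌋ + 1`), `r = ⌊√‖S‖²⌋/8 ∈
  [‖S‖/16, ‖S‖/8]`, an answer `z` is accepted iff `16‖td·zU - tw‖² ≤ td²‖S‖²` (`‖zU - t‖ ≤ ‖S‖/4`);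
* invariants: accepted answers keep the rows in `L(U)`, linearly independent, of maximal norm `≤ ‖S‖`,
  and multiply `∏‖vⱼ‖` by `≤ 7/8` (`shortening_step_approx`, the printed step with `‖t‖ ∈ [‖S‖/2, 5‖S‖/8]`
  in place of `= ‖S‖/2`); good answers are accepted (`verify_of_mem_goodAnswers`); a failed promise
  means `‖S‖ ≤ 16 γ η` (`maxNorm_le_of_not_promise`).

## References

* D. Micciancio, O. Regev, *Worst-case to average-case reductions based on Gaussian measures*,
  SIAM J. Comput. 37 (2007) 267–302; authors' version (`lit read doi:10.1137/S0097539705447360`),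
  Def. 5.6 (`IncGDD`, p. 19), Lemma 5.10 and its proof (p. 24), Cor. 5.13 (p. 25), Thm. 5.23 (p. 29).
* H. Cohen, *A Course in Computational Algebraic Number Theory*, GTM 138, 1993, §2.6.3 (the integral
  inverse columns used for the orthogonal direction).
-/

noncomputable section

namespace Literature.Algebra.EuclideanLattices

namespace MRLemma510

open Finset Module Submodule Literature.Computability.Complexity Literature.Computability.Complexity.CodeFP
  Literature.Computability.Complexity.Brick Literature.Computability.Complexity.LMat GSInverse
open scoped RealInnerProductSpace

/-! ### List-vector arithmetic -/

/-- Squared Euclidean norm of an integer row. [folklore] -/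
def sqNormZ (v : List ℤ) : ℤ := dotZ v v

/-- `k • v`. [folklore] -/
def smulZ (k : ℤ) (v : List ℤ) : List ℤ := v.map (k * ·)

/-- Coordinatewise difference of two rows of length `n` (entries read with default `0`). [folklore] -/
def subZ (n : ℕ) (u v : List ℤ) : List ℤ := (List.range n).map fun j => u.getD j 0 - v.getD j 0

/-- `z ᵥ* U`: the integer combination `∑ᵢ zᵢ Uᵢ` of the rows of `U`, as a row of length `n`. [folklore] -/
def vecMulZ (n : ℕ) (z : List ℤ) (U : List (List ℤ)) : List ℤ :=
  (List.range n).map fun j => sumRange n fun i => z.getD i 0 * ent U i j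

/-- First index of a maximal entry of a list of integers (`0` on the empty list). [folklore] -/
def argmaxZ (l : List ℤ) : ℕ :=
  ((List.range l.length).foldl (fun best j => if l.getD best 0 < l.getD j 0 then j else best) 0)

/-- The squared norms of the rows. [folklore] -/
def sqNorms (V : List (List ℤ)) : List ℤ := V.map sqNormZ

/-! ### The wire format of an `IncGDD` instance on an integer lattice -/

/-- **An `IncGDD` instance on an integer lattice, as sent to a solver machine**: dimension `n`, basis
rows `U` of `Λ = L(U)`, the independent set `S` as rows `V`, the target `t = tw/td`, the radius
`r = rn/rd`, and a padding string (no meaning). [cite: MicciancioRegev2007, Def. 5.6 (p. 19)] -/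
structure IncGDDInst where
  /-- dimension -/
  n : ℕ
  /-- basis rows of the lattice `Λ = L(U)` -/
  U : List (List ℤ)
  /-- the rows of the independent set `S ⊂ Λ` -/
  V : List (List ℤ)
  /-- numerator vector of the target `t = tw / td` -/
  tw : List ℤ
  /-- denominator of the target -/
  td : ℕ
  /-- numerator of the radius `r = rn / rd` -/
  rn : ℕ
  /-- denominator of the radius -/
  rd : ℕ
  /-- padding (ignored) -/
  pad : List Bool

namespace IncGDDInst

/-- The tuple behind the wire format. [folklore] -/
def tuple (J : IncGDDInst) : (ℕ × List (List ℤ)) × (List (List ℤ) × ((List ℤ × ℕ) × ((ℕ × ℕ) × List Bool))) :=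
  ((J.n, J.U), (J.V, ((J.tw, J.td), ((J.rn, J.rd), J.pad))))

/-- The code of the tuple: `⟨⟨1ⁿ, U⟩, ⟨V, ⟨⟨tw, bin td⟩, ⟨⟨bin rn, bin rd⟩, pad⟩⟩⟩⟩` (list matrices and
rows in the `matE`/`rawE intE` formats of `CodeFP`). [folklore] -/
abbrev tupleE : (ℕ × List (List ℤ)) × (List (List ℤ) × ((List ℤ × ℕ) × ((ℕ × ℕ) × List Bool))) → List Bool :=
  pairE (pairE unE matE) (pairE matE (pairE (pairE (rawE intE) natE) (pairE (pairE natE natE) strE)))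

/-- **The instance code.** [folklore] -/
def encode (J : IncGDDInst) : List Bool := tupleE J.tuple

/-- The `i`-th row of a list matrix as a vector of `ℝⁿ` (entries read with default `0`). [folklore] -/
def rowVec (n : ℕ) (X : List (List ℤ)) (i : ℕ) : EuclideanSpace ℝ (Fin n) :=
  intVecToEuclidean n fun t => ent X i t

/-- A row of integers as a vector of `ℝⁿ`. [folklore] -/
def vecOf (n : ℕ) (v : List ℤ) : EuclideanSpace ℝ (Fin n) := intVecToEuclidean n fun t => v.getD t 0

/-- The lattice instance `(n, U)` of the wire format. [folklore] -/
def inst (J : IncGDDInst) : LatticeInstance := ⟨J.n, toMat J.n J.n J.U⟩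

/-- **The lattice `Λ = L(U) ⊆ ℝⁿ`.** [cite: MicciancioRegev2007, Def. 5.6] -/
def lattice (J : IncGDDInst) : Submodule ℤ (EuclideanSpace ℝ (Fin J.n)) := J.inst.lattice

/-- **The target `t = tw/td`.** [cite: MicciancioRegev2007, Def. 5.6] -/
def target (J : IncGDDInst) : EuclideanSpace ℝ (Fin J.n) := ((J.td : ℝ)⁻¹) • vecOf J.n J.tw

/-- **The radius `r = rn/rd`.** [cite: MicciancioRegev2007, Def. 5.6] -/
def radius (J : IncGDDInst) : ℝ := (J.rn : ℝ) / J.rd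

/-- **`‖S‖²` as an integer**: the largest squared norm of a row of `V` (`0` if `V = []`). [folklore] -/
def maxSqNorm (J : IncGDDInst) : ℤ := (sqNorms J.V).getD (argmaxZ (sqNorms J.V)) 0

/-- **`‖S‖ = max ‖sⱼ‖`**, read as `√‖S‖²`. [cite: MicciancioRegev2007, §5 (notation ‖S‖)] -/
def maxNorm (J : IncGDDInst) : ℝ := Real.sqrt J.maxSqNorm

/-- **Well-formed instances**: `U` is an `n × n` nonsingular matrix of rows, `V` lists `n` rows of length
`n` lying in `L(U)` and linearly independent over `ℝ`, `tw` has length `n`, denominators are positive,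
and `n ≥ 1`. [cite: MicciancioRegev2007, Def. 5.6] -/
structure WellFormed (J : IncGDDInst) : Prop where
  one_le_n : 1 ≤ J.n
  len_U : J.U.length = J.n
  row_U : ∀ r ∈ J.U, r.length = J.n
  det_U : (toMat J.n J.n J.U).det ≠ 0
  len_V : J.V.length = J.n
  row_V : ∀ r ∈ J.V, r.length = J.n
  mem_V : ∀ i < J.n, rowVec J.n J.V i ∈ J.lattice
  indep_V : LinearIndependent ℝ fun i : Fin J.n => rowVec J.n J.V i
  len_tw : J.tw.length = J.n
  td_pos : 0 < J.td
  rd_pos : 0 < J.rd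

/-- **The `IncGDD^{η_ε}_{γ}` promise** with `ε = 2⁻ⁿ`: `r > γ · η_{2⁻ⁿ}(Λ)`. [cite: MicciancioRegev2007, Def. 5.6 with Cor. 5.13 (φ = η_ε)] -/
def Promise (J : IncGDDInst) (γ : ℝ) : Prop :=
  γ * smoothingParameter J.lattice ((2⁻¹ : ℝ) ^ J.n) < J.radius

end IncGDDInst

/-! ### Reading answers -/

/-- **The total reader of an answer**: the items of the string (`decNil`), each read as the integer
value `ival` of a difference pair (total: every string is read). [folklore] -/
def readVec (a : List Bool) : List ℤ := (decNil a).map ival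

/-- **`readVec` inverts the row code**: a solver that outputs `rawE intE z` is read as `z`. [folklore] -/
@[simp] theorem readVec_rawE (z : List ℤ) : readVec (rawE intE z) = z := by
  simp [readVec, List.map_map, Function.comp_def, intE]

namespace IncGDDInst

/-- **The good answers to an instance** (MR07 Def. 5.6 with `g = 8`): strings read as a coefficient row
`z` of length `n` with `‖z U - t‖ ≤ ‖S‖/8 + r`. [cite: MicciancioRegev2007, Def. 5.6 (p. 19)] -/
def goodAnswers (J : IncGDDInst) : Set (List Bool) :=
  {a | (readVec a).length = J.n ∧
    ‖vecOf J.n (vecMulZ J.n (readVec a) J.U) - J.target‖ ≤ J.maxNorm / 8 + J.radius}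

end IncGDDInst

/-! ### One round of the loop -/

/-- The context of a run: dimension, basis rows of `Λ`, number of oracle calls per round, and the
common length all instance codes are padded to. [folklore] -/
structure Ctx where
  /-- dimension -/
  n : ℕ
  /-- basis rows of `Λ = L(U)` -/
  U : List (List ℤ)
  /-- oracle calls per round -/
  k₀ : ℕ
  /-- padded instance length -/
  P : ℕ

/-- The index of a longest row (first maximiser of `‖vⱼ‖²`). [cite: MicciancioRegev2007, Lemma 5.10 (proof: "identify the longest vector")] -/
def roundIdx (V : List (List ℤ)) : ℕ := argmaxZ (sqNorms V)

/-- `‖S‖²`. [folklore] -/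
def roundA (V : List (List ℤ)) : ℤ := (sqNorms V).getD (roundIdx V) 0

/-- The integral direction orthogonal to the other rows: column `i` of Cohen's integral inverse.
[cite: MicciancioRegev2007, Lemma 5.10 (proof: "t orthogonal to s₁,…,sᵢ₋₁,sᵢ₊₁,…,sₙ"); Cohen1993 §2.6.3] -/
def roundDir (V : List (List ℤ)) : List ℤ := invCol V (roundIdx V)

/-- The exponent `ℓ = 3 + size ‖w‖²` of the target's denominator `2^ℓ`. [folklore] -/
def roundL (V : List (List ℤ)) : ℕ := 3 + Nat.size (sqNormZ (roundDir V)).toNat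

/-- The multiplier `ut = ⌊√(4^ℓ ‖S‖² / (4‖w‖²))⌋ + 1`. [folklore] -/
def roundUt (V : List (List ℤ)) : ℕ :=
  Nat.sqrt (4 ^ roundL V * (roundA V).toNat / (4 * (sqNormZ (roundDir V)).toNat)) + 1

/-- The target numerator `tw = ut • w` (so `t = ut·w/2^ℓ`, `‖S‖/2 ≤ ‖t‖ ≤ 5‖S‖/8`).
[cite: MicciancioRegev2007, Lemma 5.10 (proof: "of length ‖S‖/2"), up to the factor 5/4] -/
def roundTw (V : List (List ℤ)) : List ℤ := smulZ (roundUt V) (roundDir V)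

/-- The target denominator `td = 2^ℓ`. [folklore] -/
def roundTd (V : List (List ℤ)) : ℕ := 2 ^ roundL V

/-- The radius numerator `rn = ⌊√‖S‖²⌋` (denominator `8`: `‖S‖/16 ≤ r ≤ ‖S‖/8`).
[cite: MicciancioRegev2007, Lemma 5.10 (proof: "the instance (B, S, t, ‖S‖/8)"), up to the factor 2] -/
def roundRn (V : List (List ℤ)) : ℕ := Nat.sqrt (roundA V).toNat

/-- The unpadded instance of a round. [folklore] -/
def roundInst₀ (c : Ctx) (V : List (List ℤ)) : IncGDDInst :=
  ⟨c.n, c.U, V, roundTw V, roundTd V, roundRn V, 8, []⟩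

/-- **The oracle instance of a round**, padded with `true`s (a unary numeral) to total code length `P`
(when possible). [cite: MicciancioRegev2007, Lemma 5.10 (proof: "apply the IncGDD oracle with the instance (B, S, t, ‖S‖/8)")] -/
def roundInst (c : Ctx) (V : List (List ℤ)) : IncGDDInst :=
  ⟨c.n, c.U, V, roundTw V, roundTd V, roundRn V, 8, unE (c.P - (roundInst₀ c V).encode.length)⟩

/-- **The acceptance test** of an answer `z`: length `n`, `16‖td·zU - tw‖² ≤ td²‖S‖²` (i.e.
`‖zU - t‖ ≤ ‖S‖/4`), and the clamp `‖zU‖² ≤ ‖U‖²` (automatic along a run, where `‖zU‖ ≤ 7‖S‖/8 ≤ ‖U‖`;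
it keeps the state polynomially bounded on EVERY input, which the machine needs).
[cite: MicciancioRegev2007, Lemma 5.10 (proof: "a lattice vector u within distance ‖S‖/4 from t")] -/
def verify (c : Ctx) (V : List (List ℤ)) (z : List ℤ) : Bool :=
  decide (z.length = c.n) &&
    (decide (16 * sqNormZ (subZ c.n (smulZ (roundTd V) (vecMulZ c.n z c.U)) (roundTw V)) ≤
      (roundTd V : ℤ) ^ 2 * roundA V) &&
    decide (sqNormZ (vecMulZ c.n z c.U) ≤ roundA c.U))

/-- The first accepted answer among the oracle's answers, as the new row `zU`. [folklore] -/
def firstAccepted (c : Ctx) (V : List (List ℤ)) (answers : List (List Bool)) : Option (List ℤ) :=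
  (answers.find? fun a => verify c V (readVec a)).map fun a => vecMulZ c.n (readVec a) c.U

/-- **One round** on the state `(running, V)` with the coin words of the round: if stopped, nothing;
otherwise ask the oracle `sol` on the padded instance once per coin word and replace the longest row by the
first accepted answer, or stop. [cite: MicciancioRegev2007, Lemma 5.10 (proof, p. 24)] -/
def roundUpdate (c : Ctx) (sol : List Bool → List Bool → List Bool) (st : Bool × List (List ℤ))
    (coins : List (List Bool)) : Bool × List (List ℤ) :=
  if st.1 then
    match firstAccepted c st.2 (coins.map (sol (roundInst c st.2).encode)) with
    | some u => (true, st.2.set (roundIdx st.2) u)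
    | none => (false, st.2)
  else st

/-- **The loop**: rounds driven by the list of coin blocks, from `(running, U)`. [cite: MicciancioRegev2007, Lemma 5.10 (proof: "Initially, we set S = B … repeat the process")] -/
def loopRun (c : Ctx) (sol : List Bool → List Bool → List Bool) (blocks : List (List (List Bool))) :
    Bool × List (List ℤ) :=
  blocks.foldl (roundUpdate c sol) (true, c.U)


/-! ### Reading the list arithmetic in `ℝⁿ` -/

variable {n : ℕ}

/-- Coordinates of `vecOf`. [folklore] -/
@[simp] theorem vecOf_apply (n : ℕ) (v : List ℤ) (t : Fin n) : IncGDDInst.vecOf n v t = (v.getD t 0 : ℝ) := rfl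

/-- Rows are `vecOf` of the row lists. [folklore] -/
theorem rowVec_eq_vecOf (n : ℕ) (X : List (List ℤ)) (i : ℕ) :
    IncGDDInst.rowVec n X i = IncGDDInst.vecOf n (X.getD i []) := rfl

/-- **`sqNormZ` is the squared norm** of the row read in `ℝⁿ`, for rows of length `≤ n`. [folklore] -/
theorem cast_sqNormZ {v : List ℤ} (hv : v.length ≤ n) : (sqNormZ v : ℝ) = ‖IncGDDInst.vecOf n v‖ ^ 2 := by
  rw [sqNormZ, dotZ_eq_sum v v hv hv, EuclideanSpace.norm_sq_eq]
  push_cast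
  refine Finset.sum_congr rfl fun t _ => ?_
  rw [vecOf_apply, Real.norm_eq_abs, sq_abs, sq]

/-- `sqNormZ` is a sum of squares, hence nonnegative. [folklore] -/
theorem sqNormZ_nonneg (v : List ℤ) : 0 ≤ sqNormZ v := by
  have h := cast_sqNormZ (n := v.length) (v := v) le_rfl
  exact_mod_cast (show (0 : ℝ) ≤ sqNormZ v by rw [h]; positivity)

/-- `smulZ` is scalar multiplication. [folklore] -/
theorem vecOf_smulZ (n : ℕ) (k : ℤ) (v : List ℤ) : IncGDDInst.vecOf n (smulZ k v) = (k : ℝ) • IncGDDInst.vecOf n v := by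
  ext t
  rw [PiLp.smul_apply, vecOf_apply, vecOf_apply, smulZ, List.getD_eq_getElem?_getD, List.getElem?_map,
    List.getD_eq_getElem?_getD, smul_eq_mul]
  cases v[(t : ℕ)]? <;> simp

/-- `smulZ` keeps the length. [folklore] -/
@[simp] theorem length_smulZ (k : ℤ) (v : List ℤ) : (smulZ k v).length = v.length := by simp [smulZ]

/-- `subZ n` is subtraction. [folklore] -/
theorem vecOf_subZ (n : ℕ) (u v : List ℤ) :
    IncGDDInst.vecOf n (subZ n u v) = IncGDDInst.vecOf n u - IncGDDInst.vecOf n v := by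
  ext t
  rw [PiLp.sub_apply, vecOf_apply, vecOf_apply, vecOf_apply, subZ, getD_map_range _ t.isLt]
  push_cast
  ring

/-- `subZ n` has length `n`. [folklore] -/
@[simp] theorem length_subZ (n : ℕ) (u v : List ℤ) : (subZ n u v).length = n := by simp [subZ]

/-- `vecMulZ n` has length `n`. [folklore] -/
@[simp] theorem length_vecMulZ (n : ℕ) (z : List ℤ) (U : List (List ℤ)) : (vecMulZ n z U).length = n := by
  simp [vecMulZ]

/-- **`vecMulZ` is the integer combination of the rows**: `vecOf (z ᵥ* U) = ofCoeffs` of the lattice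
instance `(n, U)` at the coefficient vector `i ↦ z[i]`. [folklore] -/
theorem vecOf_vecMulZ (n : ℕ) (z : List ℤ) (U : List (List ℤ)) :
    IncGDDInst.vecOf n (vecMulZ n z U) =
      (⟨n, toMat n n U⟩ : LatticeInstance).ofCoeffs fun i => z.getD i 0 := by
  ext t
  rw [vecOf_apply, vecMulZ, getD_map_range _ t.isLt, sumRange_eq_sum]
  simp [LatticeInstance.ofCoeffs, intVecToEuclidean_apply, Matrix.vecMul, dotProduct, toMat]

/-- Hence **`z ᵥ* U ∈ L(U)`**. [cite: MicciancioGoldwasser2002, Ch. 1 Def. 1.1] -/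
theorem vecOf_vecMulZ_mem (n : ℕ) (z : List ℤ) (U : List (List ℤ)) :
    IncGDDInst.vecOf n (vecMulZ n z U) ∈ (⟨n, toMat n n U⟩ : LatticeInstance).lattice := by
  rw [vecOf_vecMulZ]
  exact LatticeInstance.ofCoeffs_mem_lattice _ _

/-- The rows of `U` are the basis vectors of the instance `(n, U)`. [folklore] -/
theorem rowVec_eq_vec (n : ℕ) (U : List (List ℤ)) (i : Fin n) :
    IncGDDInst.rowVec n U i = (⟨n, toMat n n U⟩ : LatticeInstance).vec i := rfl

/-- **A nonzero integer row has norm `≥ 1`.** [folklore] -/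
theorem one_le_norm_vecOf {v : List ℤ} (hv : IncGDDInst.vecOf n v ≠ 0) : 1 ≤ ‖IncGDDInst.vecOf n v‖ := by
  obtain ⟨t, ht⟩ : ∃ t : Fin n, IncGDDInst.vecOf n v t ≠ 0 := by
    by_contra h
    push Not at h
    exact hv (PiLp.ext fun t => by simpa using h t)
  rw [vecOf_apply] at ht
  have hz : v.getD t 0 ≠ 0 := fun h => ht (by rw [h, Int.cast_zero])
  have h1 : (1 : ℝ) ≤ |(v.getD t 0 : ℝ)| := by
    have : (1 : ℤ) ≤ |v.getD t 0| := Int.one_le_abs hz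
    exact_mod_cast this
  calc (1 : ℝ) ≤ |(v.getD t 0 : ℝ)| := h1
    _ = ‖IncGDDInst.vecOf n v t‖ := by rw [vecOf_apply, Real.norm_eq_abs]
    _ ≤ ‖IncGDDInst.vecOf n v‖ := PiLp.norm_apply_le _ t

/-! ### The first maximiser -/

/-- The fold behind `argmaxZ` (scanning indices `< m ≤ |l|` from a start `b < |l|`) returns an index
`< |l|` whose entry dominates the start's and every scanned entry. [folklore] -/
theorem argmaxZ_fold_spec (l : List ℤ) : ∀ (m : ℕ), m ≤ l.length → ∀ (b : ℕ), b < l.length →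
    (List.range m).foldl (fun best j => if l.getD best 0 < l.getD j 0 then j else best) b < l.length ∧
    l.getD b 0 ≤ l.getD ((List.range m).foldl (fun best j => if l.getD best 0 < l.getD j 0 then j else best) b) 0 ∧
    ∀ j < m, l.getD j 0 ≤
      l.getD ((List.range m).foldl (fun best j => if l.getD best 0 < l.getD j 0 then j else best) b) 0
  | 0, _, b, hb => by simp [hb]
  | m + 1, hm, b, hb => by
    obtain ⟨h1, h2, h3⟩ := argmaxZ_fold_spec l m (Nat.le_of_succ_le hm) b hb
    simp only [List.range_succ, List.foldl_append, List.foldl_cons, List.foldl_nil]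
    set r := (List.range m).foldl (fun best j => if l.getD best 0 < l.getD j 0 then j else best) b
    by_cases hlt : l.getD r 0 < l.getD m 0
    · rw [if_pos hlt]
      refine ⟨hm, h2.trans hlt.le, fun j hj => ?_⟩
      rcases Nat.lt_succ_iff_lt_or_eq.1 hj with hj | rfl
      · exact (h3 j hj).trans hlt.le
      · exact le_rfl
    · rw [if_neg hlt]
      push Not at hlt
      refine ⟨h1, h2, fun j hj => ?_⟩
      rcases Nat.lt_succ_iff_lt_or_eq.1 hj with hj | rfl
      · exact h3 j hj
      · exact hlt

/-- **`argmaxZ l` is a valid index of a maximal entry** of a nonempty list. [folklore] -/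
theorem argmaxZ_spec {l : List ℤ} (hl : l ≠ []) :
    argmaxZ l < l.length ∧ ∀ j < l.length, l.getD j 0 ≤ l.getD (argmaxZ l) 0 := by
  have h0 : 0 < l.length := List.length_pos_iff.2 hl
  obtain ⟨h1, -, h3⟩ := argmaxZ_fold_spec l l.length le_rfl 0 h0
  exact ⟨h1, h3⟩


/-! ### The orthogonal direction (Cohen's integral inverse column) -/

/-- The padded real family of `IntegerMatrixInverseGS` is the row family `rowVec`. [folklore] -/
theorem realRows_eq_rowVec (V : List (List ℤ)) :
    realRows V V.length = fun i : Fin V.length => IncGDDInst.rowVec V.length V i := by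
  funext i
  simp only [realRows, Function.comp_apply, LinearMap.toAddMonoidHom_coe, IncGDDInst.rowVec]
  congr 1
  funext t
  simp [padFamily, ent]

/-- Independence of the rows in the form `IntegerMatrixInverseGS` consumes. [folklore] -/
theorem linearIndependent_realRows_of_rowVec {V : List (List ℤ)} (hlen : V.length = n)
    (hli : LinearIndependent ℝ fun i : Fin n => IncGDDInst.rowVec n V i) :
    LinearIndependent ℝ (realRows V V.length) := by
  subst hlen
  rwa [realRows_eq_rowVec]

/-- Real inner products of rows read in `ℝⁿ` are the integer dot products. [folklore] -/
theorem inner_vecOf_vecOf {u v : List ℤ} (hu : u.length ≤ n) (hv : v.length ≤ n) :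
    ⟪IncGDDInst.vecOf n u, IncGDDInst.vecOf n v⟫ = (dotZ u v : ℝ) := by
  rw [dotZ_eq_sum u v hu hv]
  push_cast
  simp only [IncGDDInst.vecOf, PiLp.inner_apply, intVecToEuclidean_apply, RCLike.inner_apply, conj_trivial]
  exact Finset.sum_congr rfl fun t _ => by ring

/-- **The direction is orthogonal to the other rows and has inner product `invDen V > 0` with row `i`**
(`V · gᵢ = dₙ eᵢ`). [cite: Cohen1993, §2.6.3] -/
theorem inner_rowVec_invCol {V : List (List ℤ)} (hlen : V.length = n) (hrow : ∀ r ∈ V, r.length = n)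
    (hli : LinearIndependent ℝ fun i : Fin n => IncGDDInst.rowVec n V i) {i j : ℕ} (hi : i < n) (hj : j < n) :
    ⟪IncGDDInst.rowVec n V j, IncGDDInst.vecOf n (invCol V i)⟫ = if j = i then (invDen V : ℝ) else 0 := by
  have hsq : ∀ r ∈ V, r.length = V.length := fun r hr => by rw [hrow r hr, hlen]
  have hli' := linearIndependent_realRows_of_rowVec hlen hli
  have hjl : j < V.length := hlen ▸ hj
  have hil : i < V.length := hlen ▸ hi
  have h := cast_dotZ_invCol hsq hli' hjl hil
  rw [rowVec_eq_vecOf, List.getD_eq_getElem _ _ hjl,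
    inner_vecOf_vecOf (by rw [hrow _ (List.getElem_mem hjl)]) (by rw [length_invCol, hlen]), h]

/-- `invDen V > 0` for good rows. [cite: Cohen1993, §2.6.3] -/
theorem invDen_pos_of_rowVec {V : List (List ℤ)} (hlen : V.length = n) (hrow : ∀ r ∈ V, r.length = n)
    (hli : LinearIndependent ℝ fun i : Fin n => IncGDDInst.rowVec n V i) : 0 < invDen V :=
  invDen_pos (fun r hr => by rw [hrow r hr, hlen]) (linearIndependent_realRows_of_rowVec hlen hli)

/-- **The direction lies in the orthogonal complement of the span of the other rows.**
[cite: MicciancioRegev2007, Lemma 5.10 (proof: "t orthogonal to s₁, …, sᵢ₋₁, sᵢ₊₁, …, sₙ")] -/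
theorem vecOf_invCol_mem_orthogonal {V : List (List ℤ)} (hlen : V.length = n) (hrow : ∀ r ∈ V, r.length = n)
    (hli : LinearIndependent ℝ fun i : Fin n => IncGDDInst.rowVec n V i) (i : Fin n) :
    IncGDDInst.vecOf n (invCol V i) ∈
      (span ℝ ((fun j : Fin n => IncGDDInst.rowVec n V j) '' {i}ᶜ))ᗮ := by
  rw [Submodule.mem_orthogonal]
  intro u hu
  induction hu using Submodule.span_induction with
  | mem x hx =>
    obtain ⟨j, hj, rfl⟩ := hx
    have hji : (j : ℕ) ≠ i := fun h => hj (Fin.ext h)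
    rw [inner_rowVec_invCol hlen hrow hli i.isLt j.isLt, if_neg hji]
  | zero => exact inner_zero_left _
  | add x y _ _ hx hy => rw [inner_add_left, hx, hy, add_zero]
  | smul a x _ hx => rw [inner_smul_left, hx, mul_zero]

/-- **The direction is nonzero**; its squared norm is a positive integer. [folklore] -/
theorem one_le_sqNormZ_invCol {V : List (List ℤ)} (hlen : V.length = n) (hrow : ∀ r ∈ V, r.length = n)
    (hli : LinearIndependent ℝ fun i : Fin n => IncGDDInst.rowVec n V i) (i : Fin n) :
    1 ≤ sqNormZ (invCol V i) := by
  have hne : IncGDDInst.vecOf n (invCol V i) ≠ 0 := by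
    intro h
    have h1 := inner_rowVec_invCol hlen hrow hli i.isLt i.isLt
    rw [if_pos rfl, h, inner_zero_right] at h1
    have h2 := invDen_pos_of_rowVec hlen hrow hli
    have : (0 : ℝ) < invDen V := by exact_mod_cast h2
    linarith
  have h1 := one_le_norm_vecOf hne
  have hc := cast_sqNormZ (n := n) (v := invCol V i) (by rw [length_invCol, hlen])
  have : (1 : ℝ) ≤ sqNormZ (invCol V i) := by rw [hc]; nlinarith
  exact_mod_cast this

/-! ### The target: `‖S‖/2 ≤ ‖t‖ ≤ 5‖S‖/8` -/

/-- **The multiplier's square sits in `[x, 25x/16]`, `x = 4^ℓ A/(4W)`**: with `L = 2^ℓ`, `ℓ = 3 + size W`,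
`ut = ⌊√⌊L²A/(4W)⌋⌋ + 1` one has `A/4 ≤ ut² W/L² ≤ 25A/64` for naturals `A, W ≥ 1`. [folklore] -/
theorem tMul_sq_bounds {A W : ℕ} (hA : 1 ≤ A) (hW : 1 ≤ W) :
    (A : ℝ) / 4 ≤ ((Nat.sqrt (4 ^ (3 + Nat.size W) * A / (4 * W)) + 1 : ℕ) : ℝ) ^ 2 * W /
        ((2 : ℝ) ^ (3 + Nat.size W)) ^ 2 ∧
      ((Nat.sqrt (4 ^ (3 + Nat.size W) * A / (4 * W)) + 1 : ℕ) : ℝ) ^ 2 * W /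
        ((2 : ℝ) ^ (3 + Nat.size W)) ^ 2 ≤ 25 * A / 64 := by
  set ℓ := 3 + Nat.size W with hℓ
  set N := 4 ^ ℓ * A / (4 * W) with hN
  set ut := Nat.sqrt N + 1 with hut
  have hL : (4 : ℝ) ^ ℓ = ((2 : ℝ) ^ ℓ) ^ 2 := by
    rw [← pow_mul, mul_comm, pow_mul]; norm_num
  have hLpos : (0 : ℝ) < (2 : ℝ) ^ ℓ := by positivity
  have hWpos : (0 : ℝ) < W := by exact_mod_cast hW
  -- `x = 4^ℓ A / (4W)` and `N = ⌊x⌋`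
  set x : ℝ := (4 : ℝ) ^ ℓ * A / (4 * W) with hx
  have hNle : (N : ℝ) ≤ x := by
    rw [hx, le_div_iff₀ (by positivity), hN]
    exact_mod_cast Nat.div_mul_le_self (4 ^ ℓ * A) (4 * W)
  have hxlt : x < N + 1 := by
    rw [hx, div_lt_iff₀ (by positivity), hN]
    have h := Nat.lt_div_mul_add (a := 4 ^ ℓ * A) (b := 4 * W) (by omega)
    have h' : ((4 ^ ℓ * A : ℕ) : ℝ) < ((4 ^ ℓ * A / (4 * W) * (4 * W) + 4 * W : ℕ) : ℝ) := by exact_mod_cast h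
    push_cast at h'
    linarith
  -- `ut² > x` and `ut ≤ √x + 1`
  have hut2 : x < (ut : ℝ) ^ 2 := by
    have h := Nat.lt_succ_sqrt' N
    have h' : ((N : ℕ) : ℝ) + 1 ≤ ((Nat.sqrt N + 1 : ℕ) : ℝ) ^ 2 := by exact_mod_cast h
    rw [hut]
    linarith
  have hutle : (ut : ℝ) ≤ Real.sqrt x + 1 := by
    have h := Nat.sqrt_le' N
    have h1 : ((Nat.sqrt N : ℕ) : ℝ) ≤ Real.sqrt N := by
      rw [Real.le_sqrt (by positivity) (by positivity)]
      exact_mod_cast h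
    have h2 : Real.sqrt N ≤ Real.sqrt x := Real.sqrt_le_sqrt hNle
    rw [hut]
    push_cast
    linarith
  -- `x ≥ 16`
  have hx16 : (16 : ℝ) ≤ x := by
    have hsz : W < 2 ^ Nat.size W := Nat.lt_size_self W
    have hL8 : (8 : ℝ) * (W + 1) ≤ (2 : ℝ) ^ ℓ := by
      rw [hℓ, pow_add]
      have : ((W + 1 : ℕ) : ℝ) ≤ ((2 ^ Nat.size W : ℕ) : ℝ) := by exact_mod_cast hsz
      push_cast at this
      norm_num
      nlinarith
    rw [hx, le_div_iff₀ (by positivity), hL]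
    have hA1 : (1 : ℝ) ≤ A := by exact_mod_cast hA
    have hW1 : (1 : ℝ) ≤ W := by exact_mod_cast hW
    have h64 : (64 : ℝ) * (W + 1) ^ 2 ≤ ((2 : ℝ) ^ ℓ) ^ 2 := by nlinarith
    nlinarith
  have hsx : (4 : ℝ) ≤ Real.sqrt x := by
    rw [show (4 : ℝ) = Real.sqrt 16 by rw [show (16 : ℝ) = 4 ^ 2 by norm_num, Real.sqrt_sq (by norm_num)]]
    exact Real.sqrt_le_sqrt hx16
  have hxpos : 0 ≤ x := by linarith
  have hsq : Real.sqrt x ^ 2 = x := Real.sq_sqrt hxpos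
  -- the algebra: `ut² W / L² ∈ [x W/L², (25/16) x W/L²]` and `x W / L² = A/4`
  have hxW : x * W / ((2 : ℝ) ^ ℓ) ^ 2 = A / 4 := by
    rw [hx, hL]
    field_simp
  constructor
  · calc (A : ℝ) / 4 = x * W / ((2 : ℝ) ^ ℓ) ^ 2 := hxW.symm
      _ ≤ (ut : ℝ) ^ 2 * W / ((2 : ℝ) ^ ℓ) ^ 2 := by gcongr
  · have hut25 : (ut : ℝ) ^ 2 ≤ 25 / 16 * x := by
      have h1 : (ut : ℝ) ≤ 5 / 4 * Real.sqrt x := by linarith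
      have h0 : (0 : ℝ) ≤ ut := by positivity
      nlinarith
    calc (ut : ℝ) ^ 2 * W / ((2 : ℝ) ^ ℓ) ^ 2 ≤ 25 / 16 * x * W / ((2 : ℝ) ^ ℓ) ^ 2 := by gcongr
      _ = 25 / 16 * (x * W / ((2 : ℝ) ^ ℓ) ^ 2) := by ring
      _ = 25 * (A : ℝ) / 64 := by rw [hxW]; ring

/-- **The radius numerator**: `√A/2 ≤ ⌊√A⌋ ≤ √A` for `A ≥ 1`. [folklore] -/
theorem natSqrt_bounds {A : ℕ} (hA : 1 ≤ A) :
    Real.sqrt A / 2 ≤ (Nat.sqrt A : ℝ) ∧ (Nat.sqrt A : ℝ) ≤ Real.sqrt A := by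
  have h1 : ((Nat.sqrt A : ℕ) : ℝ) ^ 2 ≤ A := by exact_mod_cast Nat.sqrt_le' A
  have h2 : (A : ℝ) < ((Nat.sqrt A : ℕ) : ℝ) ^ 2 + 2 * Nat.sqrt A + 1 := by
    have := Nat.lt_succ_sqrt' A
    have h : (A : ℝ) < ((Nat.sqrt A + 1 : ℕ) : ℝ) ^ 2 := by exact_mod_cast this
    push_cast at h
    linarith
  have h3 : (1 : ℝ) ≤ Nat.sqrt A := by
    have : 1 ≤ Nat.sqrt A := Nat.le_sqrt.2 (by simpa using hA)
    exact_mod_cast this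
  have hsA : Real.sqrt A ^ 2 = A := Real.sq_sqrt (by positivity)
  have hs0 : 0 ≤ Real.sqrt A := Real.sqrt_nonneg _
  constructor
  · -- `(2 ⌊√A⌋)² ≥ (⌊√A⌋ + 1)² > A`
    nlinarith
  · rw [Real.le_sqrt (by positivity) (by positivity)]
    exact h1


/-! ### The acceptance test in `ℝⁿ` -/

/-- `roundTd V = 2^ℓ > 0`. [folklore] -/
theorem roundTd_pos (V : List (List ℤ)) : 0 < roundTd V := by
  unfold roundTd; positivity

/-- The target of a round, read in `ℝⁿ`: `t = td⁻¹ • tw`. [folklore] -/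
def roundTargetVec (n : ℕ) (V : List (List ℤ)) : EuclideanSpace ℝ (Fin n) :=
  ((roundTd V : ℝ)⁻¹) • IncGDDInst.vecOf n (roundTw V)

/-- The target of the round's instance is `roundTargetVec`. [folklore] -/
theorem target_roundInst (c : Ctx) (V : List (List ℤ)) :
    (roundInst c V).target = roundTargetVec c.n V := rfl

/-- **The acceptance test is `‖zU - t‖ ≤ ‖S‖/4`** (for answers of length `n`): the integer inequality
`16‖td·zU - tw‖² ≤ td²·A` read in `ℝⁿ`. [cite: MicciancioRegev2007, Lemma 5.10 (proof: "within distance ‖S‖/4 from t")] -/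
theorem verify_eq_true_iff (c : Ctx) (V : List (List ℤ)) {z : List ℤ} (hz : z.length = c.n) :
    verify c V z = true ↔
      ‖IncGDDInst.vecOf c.n (vecMulZ c.n z c.U) - roundTargetVec c.n V‖ ^ 2 ≤ (roundA V : ℝ) / 16 ∧
        sqNormZ (vecMulZ c.n z c.U) ≤ roundA c.U := by
  have htd : (0 : ℝ) < roundTd V := by exact_mod_cast roundTd_pos V
  rw [verify, hz, decide_eq_true rfl, Bool.true_and, Bool.and_eq_true, decide_eq_true_iff, decide_eq_true_iff,
    and_congr_left_iff]
  intro _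
  rw [show (16 * sqNormZ (subZ c.n (smulZ (roundTd V) (vecMulZ c.n z c.U)) (roundTw V)) ≤
      (roundTd V : ℤ) ^ 2 * roundA V) ↔ ((16 * sqNormZ (subZ c.n (smulZ (roundTd V) (vecMulZ c.n z c.U))
        (roundTw V)) : ℤ) : ℝ) ≤ (((roundTd V : ℤ) ^ 2 * roundA V : ℤ) : ℝ) from Int.cast_le.symm]
  push_cast
  rw [cast_sqNormZ (n := c.n) (by rw [length_subZ]), vecOf_subZ, vecOf_smulZ]
  set u := IncGDDInst.vecOf c.n (vecMulZ c.n z c.U)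
  set w := IncGDDInst.vecOf c.n (roundTw V)
  have hsub : ((roundTd V : ℤ) : ℝ) • u - w = (roundTd V : ℝ) • (u - roundTargetVec c.n V) := by
    rw [roundTargetVec, smul_sub, smul_smul, mul_inv_cancel₀ htd.ne', one_smul]
    norm_cast
  rw [hsub, norm_smul, Real.norm_eq_abs, abs_of_pos htd, mul_pow]
  constructor
  · intro h
    rw [le_div_iff₀ (by norm_num : (0 : ℝ) < 16)]
    have h2 : (0 : ℝ) < (roundTd V : ℝ) ^ 2 := by positivity
    nlinarith
  · intro h
    have h2 : (0 : ℝ) < (roundTd V : ℝ) ^ 2 := by positivity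
    rw [le_div_iff₀ (by norm_num : (0 : ℝ) < 16)] at h
    nlinarith

/-- **Accepted answers are within `‖S‖/4` of the target** (`‖S‖ = √A`). [cite: MicciancioRegev2007, Lemma 5.10 (proof, p. 24)] -/
theorem norm_sub_le_of_verify (c : Ctx) (V : List (List ℤ)) {z : List ℤ} (h : verify c V z = true) :
    z.length = c.n ∧
      ‖IncGDDInst.vecOf c.n (vecMulZ c.n z c.U) - roundTargetVec c.n V‖ ≤ Real.sqrt (roundA V) / 4 ∧
      sqNormZ (vecMulZ c.n z c.U) ≤ roundA c.U := by
  have hz : z.length = c.n := by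
    rw [verify, Bool.and_eq_true, decide_eq_true_iff] at h
    exact h.1
  obtain ⟨h2, h3⟩ := (verify_eq_true_iff c V hz).1 h
  refine ⟨hz, ?_, h3⟩
  have hA : (0 : ℝ) ≤ roundA V := by
    have := sq_nonneg ‖IncGDDInst.vecOf c.n (vecMulZ c.n z c.U) - roundTargetVec c.n V‖
    linarith
  rw [show Real.sqrt (roundA V) / 4 = Real.sqrt ((roundA V : ℝ) / 16) by
    rw [Real.sqrt_div' _ (by norm_num : (0:ℝ) ≤ 16), show Real.sqrt 16 = 4 by
      rw [show (16 : ℝ) = 4 ^ 2 by norm_num, Real.sqrt_sq (by norm_num)]]]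
  exact Real.le_sqrt_of_sq_le h2 |> fun h => by
    rwa [Real.le_sqrt (norm_nonneg _) (by positivity)]

/-- **Answers within `‖S‖/4` of the target are accepted.** [cite: MicciancioRegev2007, Lemma 5.10 (proof, p. 24)] -/
theorem verify_of_norm_sub_le (c : Ctx) (V : List (List ℤ)) {z : List ℤ} (hz : z.length = c.n)
    (h : ‖IncGDDInst.vecOf c.n (vecMulZ c.n z c.U) - roundTargetVec c.n V‖ ≤ Real.sqrt (roundA V) / 4)
    (hA : 0 ≤ roundA V) (hclamp : sqNormZ (vecMulZ c.n z c.U) ≤ roundA c.U) : verify c V z = true := by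
  rw [verify_eq_true_iff c V hz]
  refine ⟨?_, hclamp⟩
  have hA' : (0 : ℝ) ≤ roundA V := by exact_mod_cast hA
  have hs : Real.sqrt (roundA V) ^ 2 = roundA V := Real.sq_sqrt hA'
  have h0 : 0 ≤ ‖IncGDDInst.vecOf c.n (vecMulZ c.n z c.U) - roundTargetVec c.n V‖ := norm_nonneg _
  nlinarith

/-! ### The shortening step with an approximate target length -/

/-- The potential with a general factor: replacing `sᵢ` by `u` with `‖u‖ ≤ c‖sᵢ‖` multiplies
`∏ⱼ ‖sⱼ‖` by at most `c`. [cite: MicciancioRegev2007, Lemma 5.10 (proof, p. 24)] -/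
theorem prod_norm_update_le_mul {V' : Type*} [NormedAddCommGroup V'] {s : Fin n → V'} (i : Fin n) {u : V'}
    {c : ℝ} (hu : ‖u‖ ≤ c * ‖s i‖) :
    ∏ j, ‖Function.update s i u j‖ ≤ c * ∏ j, ‖s j‖ := by
  classical
  rw [← Finset.mul_prod_erase _ _ (mem_univ i), ← Finset.mul_prod_erase univ (fun j => ‖s j‖) (mem_univ i),
    Function.update_self, ← mul_assoc]
  have heq : ∏ j ∈ univ.erase i, ‖Function.update s i u j‖ = ∏ j ∈ univ.erase i, ‖s j‖ :=
    Finset.prod_congr rfl fun j hj => by rw [Function.update_of_ne (Finset.ne_of_mem_erase hj)]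
  rw [heq]
  exact mul_le_mul_of_nonneg_right hu (Finset.prod_nonneg fun j _ => norm_nonneg _)

/-- **One step of MR07 Lemma 5.10 with `‖S‖/2 ≤ ‖t‖ ≤ 5‖S‖/8`** (the machine's rational target) in
place of `‖t‖ = ‖S‖/2`: for `s` linearly independent with longest vector `sᵢ`, `t ⊥ span {sⱼ}ⱼ≠ᵢ` and
`‖u - t‖ ≤ ‖sᵢ‖/4`, the family with `sᵢ ↦ u` is linearly independent (`‖u - t‖ < ‖t‖`), `‖u‖ ≤ 7‖sᵢ‖/8`,
its maximal norm is still `≤ ‖sᵢ‖`, and `∏‖·‖` drops by the factor `7/8`.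
[cite: MicciancioRegev2007, Lemma 5.10 (proof, p. 24) — variant with an approximate target length] -/
theorem shortening_step_approx {V' : Type*} [NormedAddCommGroup V'] [InnerProductSpace ℝ V']
    {s : Fin n → V'} (hs : LinearIndependent ℝ s) {i : Fin n}
    (hmax : ∀ j, ‖s j‖ ≤ ‖s i‖) {t : V'} (ht : t ∈ (span ℝ (s '' {i}ᶜ))ᗮ)
    (ht1 : ‖s i‖ / 2 ≤ ‖t‖) (ht2 : ‖t‖ ≤ 5 * ‖s i‖ / 8) {u : V'} (hut : ‖u - t‖ ≤ ‖s i‖ / 4) :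
    LinearIndependent ℝ (Function.update s i u) ∧ ‖u‖ ≤ 7 / 8 * ‖s i‖ ∧
      (∀ j, ‖Function.update s i u j‖ ≤ ‖s i‖) ∧
      ∏ j, ‖Function.update s i u j‖ ≤ 7 / 8 * ∏ j, ‖s j‖ := by
  have hsi : 0 < ‖s i‖ := norm_pos_iff.2 (hs.ne_zero i)
  have hlt : ‖u - t‖ < ‖t‖ := by linarith
  have hu : ‖u‖ ≤ 7 / 8 * ‖s i‖ := by
    have := norm_le_insert' u t
    linarith
  refine ⟨linearIndependent_update_of_notMem_span hs i
      (MicciancioRegev2007.notMem_span_of_norm_sub_lt ht hlt), hu, fun j => ?_,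
    prod_norm_update_le_mul i hu⟩
  by_cases hji : j = i
  · subst hji
    rw [Function.update_self]
    linarith
  · rw [Function.update_of_ne hji]
    exact hmax j


/-! ### Good row families and the invariants of a round -/

/-- **Well-formed contexts**: `n ≥ 1` and `U` an `n × n` nonsingular matrix of rows. [folklore] -/
structure Ctx.WF (c : Ctx) : Prop where
  one_le_n : 1 ≤ c.n
  len_U : c.U.length = c.n
  row_U : ∀ r ∈ c.U, r.length = c.n
  det_U : (toMat c.n c.n c.U).det ≠ 0

/-- The lattice `Λ = L(U)` of a context. [folklore] -/
def Ctx.lattice (c : Ctx) : Submodule ℤ (EuclideanSpace ℝ (Fin c.n)) :=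
  (⟨c.n, toMat c.n c.n c.U⟩ : LatticeInstance).lattice

/-- **Good row families** (the loop's invariant): `n` rows of length `n`, in `Λ`, linearly independent.
[cite: MicciancioRegev2007, Lemma 5.10 (proof: "a set of n linearly independent vectors S")] -/
structure GoodRows (c : Ctx) (V : List (List ℤ)) : Prop where
  len : V.length = c.n
  row : ∀ r ∈ V, r.length = c.n
  mem : ∀ i < c.n, IncGDDInst.rowVec c.n V i ∈ c.lattice
  indep : LinearIndependent ℝ fun i : Fin c.n => IncGDDInst.rowVec c.n V i
  bound : ∀ r ∈ V, sqNormZ r ≤ roundA c.U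

/-- The potential `∏ⱼ ‖vⱼ‖`. [cite: MicciancioRegev2007, Lemma 5.10 (proof: "log ∏ᵢ ‖sᵢ‖ decreases by a constant at each step")] -/
def potential (n : ℕ) (V : List (List ℤ)) : ℝ := ∏ j : Fin n, ‖IncGDDInst.rowVec n V j‖

/-! #### Squared norms and the maximiser -/

/-- `sqNorms` entries. [folklore] -/
theorem getD_sqNorms (V : List (List ℤ)) {j : ℕ} (hj : j < V.length) :
    (sqNorms V).getD j 0 = sqNormZ (V.getD j []) := by
  rw [sqNorms, List.getD_eq_getElem _ _ (by simpa using hj), List.getElem_map, List.getD_eq_getElem _ _ hj]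

/-- **The maximiser is a valid index and `‖vⱼ‖² ≤ A = ‖v_{i}‖²` for all rows.** [folklore] -/
theorem roundIdx_spec {V : List (List ℤ)} (hV : V ≠ []) :
    roundIdx V < V.length ∧ roundA V = sqNormZ (V.getD (roundIdx V) []) ∧
      ∀ j < V.length, sqNormZ (V.getD j []) ≤ roundA V := by
  have hne : sqNorms V ≠ [] := by simpa [sqNorms] using hV
  obtain ⟨h1, h2⟩ := argmaxZ_spec hne
  have hlen : (sqNorms V).length = V.length := by simp [sqNorms]
  rw [hlen] at h1 h2
  unfold roundA roundIdx
  have hA : (sqNorms V).getD (argmaxZ (sqNorms V)) 0 = sqNormZ (V.getD (argmaxZ (sqNorms V)) []) :=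
    getD_sqNorms V h1
  refine ⟨h1, hA, fun j hj => ?_⟩
  rw [← getD_sqNorms V hj]
  exact h2 j hj

/-- `rowsOf (toMat n n U) = U` for a square list matrix. [folklore] -/
theorem rowsOf_toMat {U : List (List ℤ)} (hlen : U.length = n) (hrow : ∀ r ∈ U, r.length = n) :
    rowsOf (toMat n n U) = U := by
  refine List.ext_getElem (by simp [rowsOf, hlen]) fun i h₁ h₂ => ?_
  refine List.ext_getElem (by simp [rowsOf, hrow _ (List.getElem_mem h₂)]) fun j h₃ h₄ => ?_
  simp only [rowsOf, List.getElem_ofFn, toMat, ent]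
  rw [List.getD_eq_getElem _ _ h₂, List.getD_eq_getElem _ _ h₄]

/-- **The start is good**: the rows of `U` themselves. [cite: MicciancioRegev2007, Lemma 5.10 (proof: "Initially, we set S = B")] -/
theorem goodRows_start {c : Ctx} (hc : c.WF) : GoodRows c c.U := by
  refine ⟨hc.len_U, hc.row_U, fun i hi => ?_, ?_, fun r hr => ?_⟩
  · rw [show IncGDDInst.rowVec c.n c.U i = (⟨c.n, toMat c.n c.n c.U⟩ : LatticeInstance).vec ⟨i, hi⟩ from rfl]
    exact subset_span (Set.mem_range_self _)
  · have h := linearIndependent_realRows_rowsOf' hc.det_U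
    rw [rowsOf_toMat hc.len_U hc.row_U] at h
    have e : realRows c.U c.n = (fun i : Fin c.n => IncGDDInst.rowVec c.n c.U i) ∘ Fin.cast hc.len_U := by
      funext i
      simp only [realRows, Function.comp_apply, LinearMap.toAddMonoidHom_coe, IncGDDInst.rowVec]
      congr 1
      funext t
      simp [padFamily, ent]
    rw [e] at h
    exact (linearIndependent_equiv (finCongr hc.len_U)).1 h
  · obtain ⟨j, hj, rfl⟩ := List.getElem_of_mem hr
    have hne : c.U ≠ [] := List.ne_nil_of_mem hr
    obtain ⟨-, -, h3⟩ := roundIdx_spec hne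
    rw [← List.getD_eq_getElem _ [] hj]
    exact h3 j hj

/-- Norms of good rows: `‖vⱼ‖² = sqNormZ vⱼ`. [folklore] -/
theorem norm_rowVec_sq {c : Ctx} {V : List (List ℤ)} (hV : GoodRows c V) {j : ℕ} (hj : j < c.n) :
    ‖IncGDDInst.rowVec c.n V j‖ ^ 2 = sqNormZ (V.getD j []) := by
  rw [rowVec_eq_vecOf, ← cast_sqNormZ]
  rw [List.getD_eq_getElem _ _ (hV.len ▸ hj), hV.row _ (List.getElem_mem _)]

/-- Good row families are nonempty lists. [folklore] -/
theorem GoodRows.ne_nil {c : Ctx} (hc : c.WF) {V : List (List ℤ)} (hV : GoodRows c V) : V ≠ [] :=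
  List.ne_nil_of_length_pos (by rw [hV.len]; exact hc.one_le_n)

/-- **For good rows, `A ≥ 1`, `‖v_i‖ = √A` and every `‖vⱼ‖ ≤ √A`** (`i` the maximiser). [folklore] -/
theorem goodRows_norms {c : Ctx} (hc : c.WF) {V : List (List ℤ)} (hV : GoodRows c V) :
    roundIdx V < c.n ∧ 1 ≤ roundA V ∧
      ‖IncGDDInst.rowVec c.n V (roundIdx V)‖ = Real.sqrt (roundA V) ∧
      ∀ j < c.n, ‖IncGDDInst.rowVec c.n V j‖ ≤ Real.sqrt (roundA V) := by
  obtain ⟨h1, h2, h3⟩ := roundIdx_spec (hV.ne_nil hc)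
  rw [hV.len] at h1 h3
  have hsq : ∀ j < c.n, ‖IncGDDInst.rowVec c.n V j‖ ^ 2 ≤ (roundA V : ℝ) := fun j hj => by
    rw [norm_rowVec_sq hV hj]; exact Int.cast_le.2 (h3 j hj)
  have hi : ‖IncGDDInst.rowVec c.n V (roundIdx V)‖ ^ 2 = (roundA V : ℝ) := by
    rw [norm_rowVec_sq hV h1]; exact congrArg (Int.cast : ℤ → ℝ) h2.symm
  have hA1 : 1 ≤ roundA V := by
    have hnz : IncGDDInst.vecOf c.n (V.getD (roundIdx V) []) ≠ 0 := by
      intro h0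
      refine hV.indep.ne_zero (⟨roundIdx V, h1⟩ : Fin c.n) ?_
      dsimp only
      rw [rowVec_eq_vecOf]
      exact h0
    have h := one_le_norm_vecOf hnz
    have hc' := cast_sqNormZ (n := c.n) (v := V.getD (roundIdx V) [])
      (by rw [List.getD_eq_getElem _ _ (hV.len ▸ h1), hV.row _ (List.getElem_mem _)])
    have h' : ((1 : ℤ) : ℝ) ≤ ((sqNormZ (V.getD (roundIdx V) []) : ℤ) : ℝ) := by
      rw [hc', Int.cast_one]; nlinarith
    rw [h2]
    exact Int.cast_le.1 h'
  refine ⟨h1, hA1, ?_, fun j hj => ?_⟩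
  · rw [← hi, Real.sqrt_sq (norm_nonneg _)]
  · rw [← Real.sqrt_sq (norm_nonneg (IncGDDInst.rowVec c.n V j))]
    exact Real.sqrt_le_sqrt (hsq j hj)

/-! #### The target of a round -/

/-- **The round's target is orthogonal to the other rows and `‖S‖/2 ≤ ‖t‖ ≤ 5‖S‖/8`.**
[cite: MicciancioRegev2007, Lemma 5.10 (proof: "t orthogonal to … of length ‖S‖/2"), variant] -/
theorem roundTargetVec_spec {c : Ctx} (hc : c.WF) {V : List (List ℤ)} (hV : GoodRows c V) :
    roundTargetVec c.n V ∈ (span ℝ ((fun j : Fin c.n => IncGDDInst.rowVec c.n V j) ''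
        {(⟨roundIdx V, (goodRows_norms hc hV).1⟩ : Fin c.n)}ᶜ))ᗮ ∧
      Real.sqrt (roundA V) / 2 ≤ ‖roundTargetVec c.n V‖ ∧
      ‖roundTargetVec c.n V‖ ≤ 5 * Real.sqrt (roundA V) / 8 := by
  obtain ⟨hi, hA1, hnorm, -⟩ := goodRows_norms hc hV
  set i : Fin c.n := ⟨roundIdx V, hi⟩
  have hW1 : 1 ≤ sqNormZ (roundDir V) := one_le_sqNormZ_invCol hV.len hV.row hV.indep i
  -- `t = (ut / 2^ℓ) • w`
  have ht : roundTargetVec c.n V = ((roundUt V : ℝ) / (2 : ℝ) ^ roundL V) • IncGDDInst.vecOf c.n (roundDir V) := by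
    rw [roundTargetVec, roundTw, vecOf_smulZ, smul_smul, roundTd]
    push_cast
    rw [div_eq_inv_mul]
  refine ⟨?_, ?_⟩
  · rw [ht]
    exact Submodule.smul_mem _ _ (vecOf_invCol_mem_orthogonal hV.len hV.row hV.indep i)
  · -- the norm: `‖t‖² = ut² W / 4^ℓ`
    have hWc : ((sqNormZ (roundDir V)).toNat : ℝ) = ‖IncGDDInst.vecOf c.n (roundDir V)‖ ^ 2 := by
      rw [← cast_sqNormZ (by rw [roundDir, length_invCol, hV.len])]
      have h0 : 0 ≤ sqNormZ (roundDir V) := by linarith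
      exact_mod_cast Int.toNat_of_nonneg h0
    have hAc : ((roundA V).toNat : ℝ) = (roundA V : ℝ) := by
      have h0 : 0 ≤ roundA V := by linarith
      exact_mod_cast Int.toNat_of_nonneg h0
    have hb := tMul_sq_bounds (A := (roundA V).toNat) (W := (sqNormZ (roundDir V)).toNat)
      (by have := Int.toNat_le_toNat hA1; simpa using this) (by have := Int.toNat_le_toNat hW1; simpa using this)
    rw [hAc, hWc] at hb
    change (roundA V : ℝ) / 4 ≤ (roundUt V : ℝ) ^ 2 * ‖IncGDDInst.vecOf c.n (roundDir V)‖ ^ 2 / ((2 : ℝ) ^ roundL V) ^ 2 ∧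
      (roundUt V : ℝ) ^ 2 * ‖IncGDDInst.vecOf c.n (roundDir V)‖ ^ 2 / ((2 : ℝ) ^ roundL V) ^ 2 ≤ 25 * (roundA V : ℝ) / 64 at hb
    have hn2 : ‖roundTargetVec c.n V‖ ^ 2 =
        (roundUt V : ℝ) ^ 2 * ‖IncGDDInst.vecOf c.n (roundDir V)‖ ^ 2 / ((2 : ℝ) ^ roundL V) ^ 2 := by
      rw [ht, norm_smul, Real.norm_eq_abs, abs_of_nonneg (by positivity), mul_pow, div_pow]
      ring
    have hA0 : (0 : ℝ) ≤ roundA V := by exact_mod_cast (le_trans (by norm_num) hA1)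
    have hsA : Real.sqrt (roundA V) ^ 2 = roundA V := Real.sq_sqrt hA0
    have hs0 : 0 ≤ Real.sqrt (roundA V) := Real.sqrt_nonneg _
    have ht0 : 0 ≤ ‖roundTargetVec c.n V‖ := norm_nonneg _
    constructor
    · nlinarith [hb.1]
    · nlinarith [hb.2]

/-! #### The first accepted answer -/

/-- What `firstAccepted` returns. [folklore] -/
theorem firstAccepted_eq_some {c : Ctx} {V : List (List ℤ)} {answers : List (List Bool)} {u : List ℤ}
    (h : firstAccepted c V answers = some u) :
    ∃ a ∈ answers, verify c V (readVec a) = true ∧ u = vecMulZ c.n (readVec a) c.U := by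
  rw [firstAccepted] at h
  cases hf : answers.find? (fun a => verify c V (readVec a)) with
  | none => rw [hf] at h; simp at h
  | some a =>
    rw [hf, Option.map_some] at h
    exact ⟨a, List.mem_of_find?_eq_some hf, by simpa using List.find?_some hf, (Option.some_injective _ h).symm⟩

/-- When nothing is accepted. [folklore] -/
theorem firstAccepted_eq_none {c : Ctx} {V : List (List ℤ)} {answers : List (List Bool)}
    (h : firstAccepted c V answers = none) : ∀ a ∈ answers, verify c V (readVec a) = false := by
  intro a ha
  rw [firstAccepted, Option.map_eq_none_iff, List.find?_eq_none] at h
  simpa using h a ha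

/-- **An answer in `goodAnswers` of the round's instance is accepted** (`r ≤ ‖S‖/8`).
[cite: MicciancioRegev2007, Lemma 5.10 (proof: "(‖S‖/8) + ‖S‖/8 = ‖S‖/4")] -/
theorem verify_of_mem_goodAnswers {c : Ctx} (hc : c.WF) {V : List (List ℤ)} (hV : GoodRows c V) {a : List Bool}
    (ha : a ∈ (roundInst c V).goodAnswers) : verify c V (readVec a) = true := by
  obtain ⟨hlen, hdist⟩ := ha
  obtain ⟨hi, hA1, hnorm, -⟩ := goodRows_norms hc hV
  have hA0 : 0 ≤ roundA V := le_trans (by norm_num) hA1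
  obtain ⟨-, ht1, ht2⟩ := roundTargetVec_spec hc hV
  -- `A ≤ A₀ = ‖U‖²`
  have hAU : roundA V ≤ roundA c.U := by
    obtain ⟨h1, h2, -⟩ := roundIdx_spec (hV.ne_nil hc)
    rw [h2, List.getD_eq_getElem _ _ h1]
    exact hV.bound _ (List.getElem_mem _)
  suffices hd : ‖IncGDDInst.vecOf c.n (vecMulZ c.n (readVec a) c.U) - roundTargetVec c.n V‖ ≤
      Real.sqrt (roundA V) / 4 by
    refine verify_of_norm_sub_le c V hlen hd hA0 ?_
    -- the clamp: `‖u‖ ≤ ‖t‖ + ‖u - t‖ ≤ 5√A/8 + √A/4 ≤ √A ≤ √A₀`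
    have hu : ‖IncGDDInst.vecOf c.n (vecMulZ c.n (readVec a) c.U)‖ ≤ Real.sqrt (roundA V) := by
      have := norm_le_insert' (IncGDDInst.vecOf c.n (vecMulZ c.n (readVec a) c.U)) (roundTargetVec c.n V)
      have hs0 : 0 ≤ Real.sqrt (roundA V) := Real.sqrt_nonneg _
      linarith
    have hA0' : (0 : ℝ) ≤ roundA V := by exact_mod_cast hA0
    have h2 : ‖IncGDDInst.vecOf c.n (vecMulZ c.n (readVec a) c.U)‖ ^ 2 ≤ roundA V := by
      calc _ ≤ Real.sqrt (roundA V) ^ 2 := by gcongr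
        _ = roundA V := Real.sq_sqrt hA0'
    rw [← cast_sqNormZ (by rw [length_vecMulZ])] at h2
    exact le_trans (Int.cast_le.1 h2) hAU
  -- `maxNorm = √A`, `radius = ⌊√A⌋/8 ≤ √A/8`
  have hmax : (roundInst c V).maxNorm = Real.sqrt (roundA V) := rfl
  have hrad : (roundInst c V).radius ≤ Real.sqrt (roundA V) / 8 := by
    change ((Nat.sqrt (roundA V).toNat : ℕ) : ℝ) / ((8 : ℕ) : ℝ) ≤ _
    have hAc : (((roundA V).toNat : ℕ) : ℝ) = (roundA V : ℝ) := by exact_mod_cast Int.toNat_of_nonneg hA0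
    have hb := (natSqrt_bounds (A := (roundA V).toNat) (by have := Int.toNat_le_toNat hA1; simpa using this)).2
    rw [hAc] at hb
    push_cast
    linarith
  have h := hdist
  rw [hmax, target_roundInst] at h
  change ‖IncGDDInst.vecOf c.n (vecMulZ c.n (readVec a) c.U) - roundTargetVec c.n V‖ ≤ _ at h
  linarith

/-- **A failed promise means `‖S‖ ≤ 16 γ η_{2⁻ⁿ}(Λ)`** (`r = ⌊√A⌋/8 ≥ ‖S‖/16`): the stopping case of
Lemma 5.10 ("when the oracle call fails, ‖S‖/8 ≤ γφ(B), hence ‖S‖ ≤ 8γφ(B)"), with the factor `16` of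
the rational radius. [cite: MicciancioRegev2007, Lemma 5.10 (proof, p. 24)] -/
theorem maxNorm_le_of_not_promise {c : Ctx} (hc : c.WF) {V : List (List ℤ)} (hV : GoodRows c V) {γ : ℝ}
    (h : ¬ (roundInst c V).Promise γ) :
    Real.sqrt (roundA V) ≤ 16 * (γ * smoothingParameter c.lattice ((2⁻¹ : ℝ) ^ c.n)) := by
  obtain ⟨-, hA1, -, -⟩ := goodRows_norms hc hV
  have hA0 : 0 ≤ roundA V := le_trans (by norm_num) hA1
  rw [IncGDDInst.Promise, not_lt] at h
  change ((Nat.sqrt (roundA V).toNat : ℕ) : ℝ) / ((8 : ℕ) : ℝ) ≤ γ * smoothingParameter c.lattice ((2⁻¹ : ℝ) ^ c.n) at h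
  have hAc : (((roundA V).toNat : ℕ) : ℝ) = (roundA V : ℝ) := by exact_mod_cast Int.toNat_of_nonneg hA0
  have hb := (natSqrt_bounds (A := (roundA V).toNat) (by have := Int.toNat_le_toNat hA1; simpa using this)).1
  rw [hAc] at hb
  push_cast at h
  linarith

/-! #### The update -/

/-- Rows after `set`. [folklore] -/
theorem getD_set_row (V : List (List ℤ)) (k i : ℕ) (u : List ℤ) :
    (V.set k u).getD i [] = if k = i ∧ k < V.length then u else V.getD i [] := by
  rw [List.getD_eq_getElem?_getD, List.getElem?_set, List.getD_eq_getElem?_getD]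
  by_cases h : k = i
  · subst h
    by_cases hk : k < V.length <;> simp [hk]
  · simp [h]

/-- The row family after `set` is `Function.update`. [folklore] -/
theorem rowVec_set {V : List (List ℤ)} (hlen : V.length = n) {i : ℕ} (hi : i < n) (u : List ℤ) :
    (fun j : Fin n => IncGDDInst.rowVec n (V.set i u) j) =
      Function.update (fun j : Fin n => IncGDDInst.rowVec n V j) ⟨i, hi⟩ (IncGDDInst.vecOf n u) := by
  funext j
  rw [rowVec_eq_vecOf, getD_set_row]
  by_cases hji : j = ⟨i, hi⟩
  · subst hji
    rw [Function.update_self, if_pos ⟨rfl, hlen ▸ hi⟩]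
  · have : ¬ (i = (j : ℕ) ∧ i < V.length) := fun h => hji (Fin.ext h.1.symm)
    rw [if_neg this, Function.update_of_ne hji, rowVec_eq_vecOf]

/-- **The invariants of an accepted answer**: with `i` the maximiser and `u = zU` accepted, the rows
`V[i ↦ u]` are good, every row has squared norm `≤ A`, `A` does not increase, and the potential drops by
`7/8`. [cite: MicciancioRegev2007, Lemma 5.10 (proof, p. 24)] -/
theorem goodRows_update {c : Ctx} (hc : c.WF) {V : List (List ℤ)} (hV : GoodRows c V) {z : List ℤ}
    (hz : verify c V z = true) :
    GoodRows c (V.set (roundIdx V) (vecMulZ c.n z c.U)) ∧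
      (∀ r ∈ V.set (roundIdx V) (vecMulZ c.n z c.U), sqNormZ r ≤ roundA V) ∧
      roundA (V.set (roundIdx V) (vecMulZ c.n z c.U)) ≤ roundA V ∧
      potential c.n (V.set (roundIdx V) (vecMulZ c.n z c.U)) ≤ 7 / 8 * potential c.n V := by
  obtain ⟨hi, hA1, hnorm, hle⟩ := goodRows_norms hc hV
  set i : Fin c.n := ⟨roundIdx V, hi⟩ with hidef
  set u := vecMulZ c.n z c.U with hudef
  set s : Fin c.n → EuclideanSpace ℝ (Fin c.n) := fun j => IncGDDInst.rowVec c.n V j with hsdef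
  obtain ⟨ht, ht1, ht2⟩ := roundTargetVec_spec hc hV
  obtain ⟨hzlen, hut, hclamp⟩ := norm_sub_le_of_verify c V hz
  have hsi : ‖s i‖ = Real.sqrt (roundA V) := hnorm
  have step := shortening_step_approx (s := s) hV.indep (i := i) (fun j => by rw [hsi]; exact hle j j.isLt)
    ht (by rw [hsi]; exact ht1) (by rw [hsi]; linarith) (u := IncGDDInst.vecOf c.n u) (by rw [hsi]; exact hut)
  obtain ⟨hind, hu78, hall, hpot⟩ := step
  have hfam := rowVec_set (V := V) hV.len hi u
  have hV' : GoodRows c (V.set (roundIdx V) u) := by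
    refine ⟨by rw [List.length_set, hV.len], fun r hr => ?_, fun j hj => ?_, ?_, fun r hr => ?_⟩
    · rcases List.mem_or_eq_of_mem_set hr with h | rfl
      · exact hV.row r h
      · rw [hudef, length_vecMulZ]
    · rw [rowVec_eq_vecOf, getD_set_row]
      split_ifs with h
      · exact vecOf_vecMulZ_mem c.n z c.U
      · rw [← rowVec_eq_vecOf]; exact hV.mem j hj
    · rw [hfam]; exact hind
    · rcases List.mem_or_eq_of_mem_set hr with h | rfl
      · exact hV.bound r h
      · exact hclamp
  -- every row has squared norm `≤ A`
  have hrows : ∀ j < c.n, sqNormZ ((V.set (roundIdx V) u).getD j []) ≤ roundA V := by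
    intro j hj
    have h1 : ‖IncGDDInst.rowVec c.n (V.set (roundIdx V) u) j‖ ≤ Real.sqrt (roundA V) := by
      have h := hall ⟨j, hj⟩
      have e := congrFun hfam ⟨j, hj⟩
      dsimp only at e
      rw [← e, hsi] at h
      exact h
    have h2 := norm_rowVec_sq hV' hj
    have hA0 : (0 : ℝ) ≤ roundA V := by exact_mod_cast (le_trans (by norm_num) hA1)
    have h3 : ‖IncGDDInst.rowVec c.n (V.set (roundIdx V) u) j‖ ^ 2 ≤ roundA V := by
      calc _ ≤ Real.sqrt (roundA V) ^ 2 := by gcongr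
        _ = roundA V := Real.sq_sqrt hA0
    rw [h2] at h3
    exact_mod_cast h3
  refine ⟨hV', fun r hr => ?_, ?_, ?_⟩
  · obtain ⟨j, hj, rfl⟩ := List.getElem_of_mem hr
    rw [List.length_set, hV.len] at hj
    rw [← List.getD_eq_getElem _ [] (by rw [List.length_set, hV.len]; exact hj)]
    exact hrows j hj
  · obtain ⟨h1, h2, -⟩ := roundIdx_spec (hV'.ne_nil hc)
    rw [h2]
    rw [List.length_set, hV.len] at h1
    exact hrows _ h1
  · change ∏ j : Fin c.n, ‖IncGDDInst.rowVec c.n (V.set (roundIdx V) u) j‖ ≤ 7 / 8 * ∏ j : Fin c.n, ‖s j‖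
    calc ∏ j : Fin c.n, ‖IncGDDInst.rowVec c.n (V.set (roundIdx V) u) j‖
        = ∏ j : Fin c.n, ‖Function.update s i (IncGDDInst.vecOf c.n u) j‖ := by
          refine Finset.prod_congr rfl fun j _ => ?_
          have e := congrFun hfam j
          rw [e]
      _ ≤ 7 / 8 * ∏ j : Fin c.n, ‖s j‖ := hpot

/-- **One round from a good running state**: either some answer was accepted and the new rows are good
with `A` non-increasing, all squared norms `≤ A` and potential `≤ 7/8` of before; or no answer was
accepted (in particular no answer was good) and the loop stops with the rows unchanged.
[cite: MicciancioRegev2007, Lemma 5.10 (proof, p. 24)] -/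
theorem roundUpdate_running {c : Ctx} (hc : c.WF) (sol : List Bool → List Bool → List Bool)
    {V : List (List ℤ)} (hV : GoodRows c V) (coins : List (List Bool)) :
    (∃ V', roundUpdate c sol (true, V) coins = (true, V') ∧ GoodRows c V' ∧
        (∀ r ∈ V', sqNormZ r ≤ roundA V) ∧ roundA V' ≤ roundA V ∧
        potential c.n V' ≤ 7 / 8 * potential c.n V) ∨
      (roundUpdate c sol (true, V) coins = (false, V) ∧
        ∀ w ∈ coins, sol (roundInst c V).encode w ∉ (roundInst c V).goodAnswers) := by
  unfold roundUpdate
  simp only [ite_true]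
  cases h : firstAccepted c V (coins.map (sol (roundInst c V).encode)) with
  | none =>
    right
    refine ⟨rfl, fun w hw hgood => ?_⟩
    have h1 := firstAccepted_eq_none h _ (List.mem_map.2 ⟨w, hw, rfl⟩)
    have h2 := verify_of_mem_goodAnswers hc hV hgood
    rw [h1] at h2
    exact Bool.false_ne_true h2
  | some u =>
    left
    obtain ⟨a, -, hv, rfl⟩ := firstAccepted_eq_some h
    obtain ⟨h1, h2, h3, h4⟩ := goodRows_update hc hV hv
    exact ⟨_, rfl, h1, h2, h3, h4⟩

/-- A stopped state stays put. [folklore] -/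
@[simp] theorem roundUpdate_stopped (c : Ctx) (sol : List Bool → List Bool → List Bool) (V : List (List ℤ))
    (coins : List (List Bool)) : roundUpdate c sol (false, V) coins = (false, V) := by
  simp [roundUpdate]

/-- **The potential of good rows is `≥ 1`** (nonzero integer rows have norm `≥ 1`).
[cite: MicciancioRegev2007, Lemma 5.10 (proof: termination), integer-lattice form] -/
theorem one_le_potential {c : Ctx} {V : List (List ℤ)} (hV : GoodRows c V) : 1 ≤ potential c.n V := by
  unfold potential
  calc (1 : ℝ) = ∏ _j : Fin c.n, (1 : ℝ) := by simp
    _ ≤ ∏ j : Fin c.n, ‖IncGDDInst.rowVec c.n V j‖ :=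
        Finset.prod_le_prod (fun _ _ => zero_le_one) fun j _ => one_le_norm_vecOf (hV.indep.ne_zero j)

/-- **The potential of good rows is `≤ (√A)ⁿ`.** [folklore] -/
theorem potential_le_pow {c : Ctx} (hc : c.WF) {V : List (List ℤ)} (hV : GoodRows c V) :
    potential c.n V ≤ Real.sqrt (roundA V) ^ c.n := by
  obtain ⟨-, -, -, hle⟩ := goodRows_norms hc hV
  unfold potential
  calc ∏ j : Fin c.n, ‖IncGDDInst.rowVec c.n V j‖ ≤ ∏ _j : Fin c.n, Real.sqrt (roundA V) :=
        Finset.prod_le_prod (fun _ _ => norm_nonneg _) fun j _ => hle j j.isLt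
    _ = Real.sqrt (roundA V) ^ c.n := by simp


/-! ### The round's instance is well formed; code lengths -/

/-- The dimension of the round's instance. [folklore] -/
@[simp] theorem roundInst_n (c : Ctx) (V : List (List ℤ)) : (roundInst c V).n = c.n := rfl

/-- The lattice of the round's instance is the context's. [folklore] -/
theorem roundInst_lattice (c : Ctx) (V : List (List ℤ)) : (roundInst c V).lattice = c.lattice := rfl

/-- **The round's instance is a well-formed `IncGDD` instance** from a good state.
[cite: MicciancioRegev2007, Lemma 5.10 (proof: "the instance (B, S, t, ‖S‖/8)") with Def. 5.6] -/
theorem wellFormed_roundInst {c : Ctx} (hc : c.WF) {V : List (List ℤ)} (hV : GoodRows c V) :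
    (roundInst c V).WellFormed where
  one_le_n := hc.one_le_n
  len_U := hc.len_U
  row_U := hc.row_U
  det_U := hc.det_U
  len_V := hV.len
  row_V := hV.row
  mem_V := hV.mem
  indep_V := hV.indep
  len_tw := by
    show (smulZ (roundUt V) (roundDir V)).length = c.n
    rw [length_smulZ, roundDir, length_invCol, hV.len]
  td_pos := roundTd_pos V
  rd_pos := by show 0 < 8; norm_num

/-- The code length of an instance is that of its unpadded version plus the padding. [folklore] -/
theorem length_encode (J : IncGDDInst) :
    J.encode.length = (⟨J.n, J.U, J.V, J.tw, J.td, J.rn, J.rd, []⟩ : IncGDDInst).encode.length + J.pad.length := by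
  simp only [IncGDDInst.encode, IncGDDInst.tuple, pairE_apply, length_boolPair]
  simp only [strE, id, List.length_nil]
  omega

/-- **Padding equalises the code length**: the round's instance has code length exactly `P`, as soon as
`P` covers the unpadded code. [folklore] -/
theorem length_encode_roundInst (c : Ctx) (V : List (List ℤ)) (hP : (roundInst₀ c V).encode.length ≤ c.P) :
    (roundInst c V).encode.length = c.P := by
  rw [length_encode]
  change (roundInst₀ c V).encode.length + (unE (c.P - (roundInst₀ c V).encode.length)).length = c.P
  rw [length_unE]
  omega


/-! ### The run on a coin string -/

/-- **The coin blocks of a run**: round `j < T` reads the `j`-th chunk of width `K·k₀` of the coin string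
(`Cryptography.chunk`), cut into `k₀` words of width `K` (one per oracle call).
[cite: AroraBarak2009, Def. 7.1 (a probabilistic machine reads a random string)] -/
def blocksOf (K k₀ T : ℕ) (r : List Bool) : List (List (List Bool)) :=
  (List.range T).map fun j => (List.range k₀).map fun l =>
    Literature.Computability.Cryptography.chunk K (Literature.Computability.Cryptography.chunk (K * k₀) r j) l

/-- The words of one block. [folklore] -/
def wordsOf (K k₀ : ℕ) (b : List Bool) : List (List Bool) :=
  (List.range k₀).map fun l => Literature.Computability.Cryptography.chunk K b l

/-- **The loop run on a coin string**: `T` rounds, `k₀` oracle calls per round with coin words of width `K`.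
[cite: MicciancioRegev2007, Lemma 5.10 (the reduction) with Cor. 5.13 (probabilistic oracle)] -/
def loopOut (c : Ctx) (sol : List Bool → List Bool → List Bool) (K T : ℕ) (r : List Bool) : Bool × List (List ℤ) :=
  loopRun c sol (blocksOf K c.k₀ T r)

end MRLemma510

end Literature.Algebra.EuclideanLattices

end
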